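import Mathlib
import HarnessLib
import Summits.CriticalPhenomena.CardyFormulaZ2.Theses.CardyGluingRDE

/-!
# `CardyGluingRDE.BoxMerging` = common limit of the two square laws (stmt-CriticalPhenomena-8582)

Item `BoxMerging` of route `CardyGluingRDE` (sub-problem `CardyFormulaZ2`) asks that the
total-variation distance `TV_j(u,u')` between the bond-`ℤ²` (mesh `u`) and site-`𝕋` (mesh `u'`)
laws of the resolution-`j` boundary-segment connectivity matrix of the square tend to `0` as
`u, u' → 0⁺` INDEPENDENTLY.  Because the two meshes are decoupled, this is equivalent to the
conjunction "the `ℤ²` law converges as `u → 0⁺`" ∧ "the `𝕋` law converges as `u' → 0⁺`" ∧ "the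
two limits coincide" (`BoxMerging_iff_common_limit`): the `𝕋` half is the Camia–Newman / Smirnov
scaling limit of site percolation on `𝕋`, the `ℤ²` half (existence of the limit of JOINT crossing
laws of a square for bond percolation on `ℤ²`, e.g. of `P[H ∧ V]`, plus its identification with
the `𝕋` value) is the open universality problem (Schramm–Smirnov 2011, §1).  The real analysis is
proved once for abstract families `p q : ℝ → ι → ℝ` (`merging_iff_common_limit`: a family that is
uniformly `ℓ¹`-close to an independent second family near `0⁺` is Cauchy, hence convergent in the
complete space `ι → ℝ`, and conversely), then instantiated by unfolding the route definition.
-/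

namespace Summit.CriticalPhenomena.CardyFormulaZ2.Theorems

open Filter Topology Finset
open Summit.CriticalPhenomena.CardyFormulaZ2.Theses.CardyGluingRDE

section Abstract

variable {ι : Type*} [Fintype ι]

/-- An `ℓ¹` bound `Σ_i |x_i - y_i| ≤ C` bounds the sup distance on `ι → ℝ` by `C`. [folklore] -/
theorem BoxMerging_dist_le_of_sum_abs_sub_le {x y : ι → ℝ} {C : ℝ} (hC : 0 ≤ C)
    (h : ∑ i, |x i - y i| ≤ C) : dist x y ≤ C := by
  refine (dist_pi_le_iff hC).2 fun i => ?_
  rw [Real.dist_eq]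
  exact (single_le_sum (f := fun i => |x i - y i|) (fun i _ => abs_nonneg _) (mem_univ i)).trans h

/-- The `ℓ¹` distance on `ι → ℝ` is at most `|ι|` times the sup distance. [folklore] -/
theorem BoxMerging_sum_abs_sub_le_card_mul_dist (x y : ι → ℝ) :
    ∑ i, |x i - y i| ≤ Fintype.card ι * dist x y := by
  calc ∑ i, |x i - y i| ≤ ∑ _i : ι, dist x y :=
        sum_le_sum fun i _ => by rw [← Real.dist_eq]; exact dist_le_pi_dist x y i
    _ = Fintype.card ι * dist x y := by simp [Finset.card_univ]

/-- **Merging of two independently indexed families = common limit.**  For families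
`p q : ℝ → ι → ℝ` (`ι` finite): `½ Σ_i |p u i - q u' i| ≤ ε` for all `u, u' ∈ (0, η(ε))`
(the shape of the body of `BoxMerging`, the two mesh parameters varying independently) holds iff
`p` and `q` converge along `𝓝[>] 0` to one and the same limit.  (`⇒`: fixing `u` makes `q`
uniformly Cauchy near `0⁺`, so `q(1/(n+1))` converges in the complete space `ι → ℝ` and the
uniform estimate upgrades this to `q → π` and then `p → π`; `⇐`: triangle inequality.) [folklore] -/
theorem merging_iff_common_limit (p q : ℝ → ι → ℝ) :
    (∀ ε : ℝ, 0 < ε → ∃ η : ℝ, 0 < η ∧ ∀ u u' : ℝ, 0 < u → u < η → 0 < u' → u' < η →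
        (1 / 2 : ℝ) * ∑ i, |p u i - q u' i| ≤ ε) ↔
      ∃ π : ι → ℝ, Tendsto p (𝓝[>] 0) (𝓝 π) ∧ Tendsto q (𝓝[>] 0) (𝓝 π) := by
  constructor
  · intro h
    -- uniform closeness of the two families in the sup distance
    have hclose : ∀ ε : ℝ, 0 < ε → ∃ η : ℝ, 0 < η ∧ ∀ u u' : ℝ, 0 < u → u < η → 0 < u' →
        u' < η → dist (p u) (q u') ≤ ε := by
      intro ε hε
      obtain ⟨η, hη, hη'⟩ := h (ε / 2) (half_pos hε)
      refine ⟨η, hη, fun u u' hu huη hu' hu'η => BoxMerging_dist_le_of_sum_abs_sub_le hε.le ?_⟩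
      have := hη' u u' hu huη hu' hu'η
      linarith
    -- the sequence `q (1/(n+1))` is Cauchy, hence converges
    set s : ℕ → ι → ℝ := fun n => q (1 / ((n : ℝ) + 1)) with hs
    have hsC : CauchySeq s := by
      refine Metric.cauchySeq_iff'.2 fun ε hε => ?_
      obtain ⟨η, hη, hη'⟩ := hclose (ε / 4) (by positivity)
      obtain ⟨N, hN⟩ := exists_nat_one_div_lt hη
      refine ⟨N, fun n hn => ?_⟩
      have hn' : 1 / ((n : ℝ) + 1) < η :=
        lt_of_le_of_lt (by gcongr) hN
      have h1 := hη' (η / 2) (1 / ((n : ℝ) + 1)) (half_pos hη) (half_lt_self hη) (by positivity) hn'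
      have h2 := hη' (η / 2) (1 / ((N : ℝ) + 1)) (half_pos hη) (half_lt_self hη) (by positivity) hN
      calc dist (s n) (s N) ≤ dist (p (η / 2)) (s n) + dist (p (η / 2)) (s N) :=
            dist_triangle_left _ _ _
        _ ≤ ε / 4 + ε / 4 := add_le_add h1 h2
        _ < ε := by linarith
    obtain ⟨π, hπ⟩ := cauchySeq_tendsto_of_complete hsC
    -- `q → π` along `𝓝[>] 0`
    have hq : Tendsto q (𝓝[>] 0) (𝓝 π) := by
      refine Metric.tendsto_nhdsWithin_nhds.2 fun ε hε => ?_
      obtain ⟨η, hη, hη'⟩ := hclose (ε / 4) (by positivity)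
      refine ⟨η, hη, fun u' hu' hd => ?_⟩
      rw [Set.mem_Ioi] at hu'
      rw [Real.dist_eq, sub_zero, abs_of_pos hu'] at hd
      have hev : ∀ᶠ n : ℕ in atTop, dist (s n) π < ε / 4 :=
        (Metric.tendsto_nhds.1 hπ) (ε / 4) (by positivity)
      have hev2 : ∀ᶠ n : ℕ in atTop, 1 / ((n : ℝ) + 1) < η := by
        obtain ⟨N, hN⟩ := exists_nat_one_div_lt hη
        exact eventually_atTop.2 ⟨N, fun n hn => lt_of_le_of_lt (by gcongr) hN⟩
      obtain ⟨n, hn1, hn2⟩ := (hev.and hev2).exists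
      have h1 := hη' (η / 2) u' (half_pos hη) (half_lt_self hη) hu' hd
      have h2 := hη' (η / 2) (1 / ((n : ℝ) + 1)) (half_pos hη) (half_lt_self hη) (by positivity) hn2
      have h3 : dist (q u') (s n) ≤ dist (p (η / 2)) (q u') + dist (p (η / 2)) (s n) :=
        dist_triangle_left _ _ _
      have h4 : dist (q u') π ≤ dist (q u') (s n) + dist (s n) π := dist_triangle _ _ _
      linarith
    refine ⟨π, ?_, hq⟩
    -- `p → π` along `𝓝[>] 0`
    refine Metric.tendsto_nhdsWithin_nhds.2 fun ε hε => ?_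
    obtain ⟨η, hη, hη'⟩ := hclose (ε / 4) (by positivity)
    refine ⟨η, hη, fun u hu hd => ?_⟩
    rw [Set.mem_Ioi] at hu
    rw [Real.dist_eq, sub_zero, abs_of_pos hu] at hd
    have hev : ∀ᶠ u' : ℝ in 𝓝[>] 0, dist (q u') π < ε / 4 :=
      (Metric.tendsto_nhds.1 hq) (ε / 4) (by positivity)
    have hev2 : ∀ᶠ u' : ℝ in 𝓝[>] 0, u' ∈ Set.Ioo 0 η := Ioo_mem_nhdsGT hη
    obtain ⟨u', h1, h2⟩ := (hev.and hev2).exists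
    have h3 := hη' u u' hu hd h2.1 h2.2
    have h4 : dist (p u) π ≤ dist (p u) (q u') + dist (q u') π := dist_triangle _ _ _
    linarith
  · rintro ⟨π, hp, hq⟩ ε hε
    have hcard : (0 : ℝ) ≤ Fintype.card ι := Nat.cast_nonneg _
    have hε' : 0 < ε / ((Fintype.card ι : ℝ) + 1) := by positivity
    obtain ⟨η₁, hη₁, h₁⟩ := Metric.tendsto_nhdsWithin_nhds.1 hp _ hε'
    obtain ⟨η₂, hη₂, h₂⟩ := Metric.tendsto_nhdsWithin_nhds.1 hq _ hε'
    refine ⟨min η₁ η₂, lt_min hη₁ hη₂, fun u u' hu huη hu' hu'η => ?_⟩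
    have hdu : dist (p u) π < ε / ((Fintype.card ι : ℝ) + 1) := by
      refine h₁ (Set.mem_Ioi.2 hu) ?_
      rw [Real.dist_eq, sub_zero, abs_of_pos hu]
      exact lt_of_lt_of_le huη (min_le_left _ _)
    have hdu' : dist (q u') π < ε / ((Fintype.card ι : ℝ) + 1) := by
      refine h₂ (Set.mem_Ioi.2 hu') ?_
      rw [Real.dist_eq, sub_zero, abs_of_pos hu']
      exact lt_of_lt_of_le hu'η (min_le_right _ _)
    have hd : dist (p u) (q u') ≤ 2 * (ε / ((Fintype.card ι : ℝ) + 1)) := by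
      have := dist_triangle_right (p u) (q u') π
      linarith
    have hsum := BoxMerging_sum_abs_sub_le_card_mul_dist (p u) (q u')
    have hkey : (Fintype.card ι : ℝ) * (2 * (ε / ((Fintype.card ι : ℝ) + 1))) ≤ 2 * ε := by
      rw [← mul_assoc, mul_comm _ (2 : ℝ), mul_assoc, mul_div_assoc']
      refine mul_le_mul_of_nonneg_left ?_ zero_le_two
      rw [div_le_iff₀ (by positivity)]
      nlinarith
    have := mul_le_mul_of_nonneg_left hd hcard
    linarith

end Abstract

/-- **`BoxMerging` ↔ the bond-`ℤ²` and site-`𝕋` square laws have a common limit.**  The route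
statement `BoxMerging` (merging in total variation of the resolution-`j` boundary-segment
connectivity laws of the square of side `δ₀`, the two meshes `u, u' → 0⁺` independently) holds
iff for every `δ₀ > 0` and `j` there is ONE law `π` on connectivity matrices to which the
bond-`ℤ²` law converges as `u → 0⁺` AND the site-`𝕋` law converges as `u' → 0⁺`.  The `𝕋` half is
the Camia–Newman/Smirnov full scaling limit on `𝕋`; the `ℤ²` half (existence of the scaling limit
of joint crossing laws of a square for bond-`ℤ²` and its agreement with `𝕋`) is the universality
problem, open stand-alone — inside the route it is supplied by the crux `GluingContraction` via
`BoxMerging_of_GluingContraction`.  Instance of `merging_iff_common_limit`. [folklore] -/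
theorem BoxMerging_iff_common_limit :
    BoxMerging ↔
      (let PZ := Literature.Probability.Percolation.bondPercolation
          (Literature.Probability.LatticeModels.zdGraph 2) Literature.Probability.Percolation.half
        let PT := Literature.Probability.LatticeModels.triSitePercolation
          Literature.Probability.Percolation.half
        let Sq : ℝ → Set ℂ := fun δ₀ => {z : ℂ | 0 < z.re ∧ z.re < δ₀ ∧ 0 < z.im ∧ z.im < δ₀}
        let seg : (δ₀ : ℝ) → (j : ℕ) → Fin 4 × Fin (2 ^ j) → Set ℂ := fun δ₀ j a =>
          {z : ℂ | (a.1 = 0 ∧ z.im = 0 ∧ δ₀ * ((a.2 : ℕ) : ℝ) / 2 ^ j ≤ z.re ∧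
              z.re ≤ δ₀ * (((a.2 : ℕ) : ℝ) + 1) / 2 ^ j) ∨
            (a.1 = 1 ∧ z.re = δ₀ ∧ δ₀ * ((a.2 : ℕ) : ℝ) / 2 ^ j ≤ z.im ∧
              z.im ≤ δ₀ * (((a.2 : ℕ) : ℝ) + 1) / 2 ^ j) ∨
            (a.1 = 2 ∧ z.im = δ₀ ∧ δ₀ * ((a.2 : ℕ) : ℝ) / 2 ^ j ≤ z.re ∧
              z.re ≤ δ₀ * (((a.2 : ℕ) : ℝ) + 1) / 2 ^ j) ∨
            (a.1 = 3 ∧ z.re = 0 ∧ δ₀ * ((a.2 : ℕ) : ℝ) / 2 ^ j ≤ z.im ∧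
              z.im ≤ δ₀ * (((a.2 : ℕ) : ℝ) + 1) / 2 ^ j)}
        let EZ : (δ₀ : ℝ) → (j : ℕ) → ℝ → ((Fin 4 × Fin (2 ^ j)) → (Fin 4 × Fin (2 ^ j)) → Bool) →
            Set (Literature.Probability.Percolation.BondConfig
              (Literature.Probability.LatticeModels.Site 2)) := fun δ₀ j u M =>
          {ω | ∀ a b, ω ∈ Literature.Probability.Percolation.discreteCrossing (Sq δ₀) u
            (seg δ₀ j a) (seg δ₀ j b) ↔ M a b = true}
        let ET : (δ₀ : ℝ) → (j : ℕ) → ℝ → ((Fin 4 × Fin (2 ^ j)) → (Fin 4 × Fin (2 ^ j)) → Bool) →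
            Set (Literature.Probability.Percolation.SiteConfig
              (Literature.Probability.LatticeModels.Site 2)) := fun δ₀ j u M =>
          {ω | ∀ a b, ω ∈ Literature.Probability.LatticeModels.triCrossing (Sq δ₀) u
            (seg δ₀ j a) (seg δ₀ j b) ↔ M a b = true}
        ∀ δ₀ : ℝ, 0 < δ₀ → ∀ j : ℕ,
          ∃ π : ((Fin 4 × Fin (2 ^ j)) → (Fin 4 × Fin (2 ^ j)) → Bool) → ℝ,
            Tendsto (fun u M => PZ.real (EZ δ₀ j u M)) (𝓝[>] 0) (𝓝 π) ∧
              Tendsto (fun u' M => PT.real (ET δ₀ j u' M)) (𝓝[>] 0) (𝓝 π)) := by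
  unfold BoxMerging
  dsimp only
  refine forall₂_congr fun δ₀ _ => forall_congr' fun j => ?_
  exact merging_iff_common_limit _ _

end Summit.CriticalPhenomena.CardyFormulaZ2.Theorems
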